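import Literature.Analysis.FluidPDE.NSSerrinRegularityTao
import Literature.Analysis.FluidPDE.TaoH1AlmostRegularAssembly
import Literature.Analysis.FluidPDE.TaoH1FourierDecompositionProofs
import Literature.Analysis.FluidPDE.TaoH1FourierLocalExistenceHolds
import Literature.Analysis.FluidPDE.CheskidovShvydkoyReduction
import HarnessLib

/-!
# Discharge of `leray_continuation_H1` (Cheskidov–Shvydkoy 2010, Thm. 2.4, `s = 1`) and of the
# whole of Tao's local `H¹` chain behind it

Analysis/FluidPDE proof file (no definitions, no named facts), sibling of
`CheskidovShvydkoyRegular.lean`, which vendors Cheskidov–Shvydkoy's "Theorem 2.4 (Leray)"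
(A. Cheskidov, R. Shvydkoy, *The regularity of weak solutions of the 3D Navier–Stokes equations in
`B^{-1}_{∞,∞}`*, Arch. Ration. Mech. Anal. 195 (2010) 159–169 = arXiv:0708.3067, p. 4: "Let `u(t)`
be a Leray–Hopf solution of (NSE) on `[0,T]`. If for every interval of regularity `(α, β) ⊂ (0,T)`,
`limsup_{t → β-} ‖u(t)‖_{H^s} < ∞` for some `s > 1/2`, then `u(t)` is regular on `(0,T]`") in the
case `s = 1` as the named fact `leray_continuation_H1`.

The authors call it "a well-known fact concerning Leray–Hopf solutions": it is Leray's structure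
theory (Leray 1934, §§ 19–24 and Ch. IV; Robinson–Rodrigo–Sadowski 2016, Thm. 6.8/6.15, Lemma 6.11,
§8.1 and Thm. 8.14) — restart the weak solution at a good time from its `H¹` slice, run the local
strong solution, identify the two by weak–strong uniqueness, and use the bound on `‖u(t)‖_{H¹}` to
the left of `β` to push the interval of regularity past `β`. Every step of that argument is already
**proved** in the tree, the local existence theory being Tao's quantitative `H¹` theory
(T. Tao, *Localisation and compactness properties of the Navier–Stokes global regularity problem*,
Anal. PDE 6 (2013) = arXiv:1108.1165, Thm. 5.4) run on the Fourier side: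

* `sobolev_fourierDatum_of_smooth_holds` (`TaoH1FourierDecompositionProofs`): Plancherel for
  smooth `H^∞` fields;
* `tao2011_fourier_local_existence_holds` (`TaoH1FourierLocalExistenceHolds`): Thm. 5.4 (ii)+(iv)
  for Fourier data (the `X¹` Picard iteration `tao2011_sobolevMild_exists_holds` and the synthesis
  `sobolevMild_classical_holds`);
* `tao2011_smooth_local_existence_of_fourier` (`TaoH1FourierDecomposition`): the two give Thm. 5.4
  (ii)+(iv) for smooth `H^∞` data, `tao2011_smooth_local_existence`;
* `tao2011_H1_local_almost_regular_of_smooth_local_existence` (`TaoH1AlmostRegularAssembly`):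
  mollification, the enstrophy a priori bound, `L²` stability and the Leray–Hopf limit give
  Thm. 5.4 (ii) with Prop. 5.6 for general `H¹` data, `tao2011_H1_local_almost_regular`;
* `leray_continuation_H1_of_tao`, `ladyzhenskaya_prodi_serrin_of_tao`, `serrin_regularity_H1_of_tao`
  (`NSSerrinRegularityTao`): the continuation theorem, and with it the Ladyzhenskaya–Prodi–Serrin
  criterion ns.S07 and RRS Lemma 8.16, from `tao2011_H1_local_almost_regular`;
* `cheskidov_shvydkoy_of_regular` (`CheskidovShvydkoyReduction`): Cheskidov–Shvydkoy's Thm. 3.1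
  from their Lemma 3.2, Thm. 2.4 and ns.S07.

This file composes them. **Discharged here** (each `theorem X_holds : X`, no hypotheses):
`tao2011_smooth_local_existence`, `tao2011_H1_local_almost_regular`, `leray_continuation_H1`,
`ladyzhenskaya_prodi_serrin` (ns.S07), `serrin_regularity_H1`. **Proved reduction**:
`cheskidov_shvydkoy_of_dyadic_regular` — the accepted `cheskidov_shvydkoy` (ns.S31) now rests on
the single named fact `cheskidov_shvydkoy_dyadic_regular` (Cheskidov–Shvydkoy 2010, Lemma 3.2).
Nothing is defined; no statement is changed.

## Mathlib / tree search

`lean search '<name>_holds'` for each of the five facts: absent before this file (2026-08-15).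
All ingredients listed above are accepted tree theorems; Mathlib has no Navier–Stokes theory.

## References

* A. Cheskidov, R. Shvydkoy, Arch. Ration. Mech. Anal. 195 (2010) 159–169 = arXiv:0708.3067,
  Thm. 2.4 (p. 4), Thm. 3.1 and Lemma 3.2 (p. 5), proof of Thm. 3.1 (p. 6). [CheskidovShvydkoy2010]
* T. Tao, Anal. PDE 6 (2013) 25–107 = arXiv:1108.1165, Thm. 5.4 (arXiv Thm. 31, p. 18) (i), (ii),
  (iv), Prop. 5.6. [Tao2011]
* J. C. Robinson, J. L. Rodrigo, W. Sadowski, *The Three-Dimensional Navier–Stokes Equations*,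
  CUP 2016, Thm. 6.15, Lemma 6.11, Thm. 8.14, Lemma 8.16, Thm. 8.17. [RobinsonRodrigoSadowski2016]
* J. Leray, Acta Math. 63 (1934), §§ 19–24, Ch. IV. [Leray1934]
-/

noncomputable section

namespace Literature.Analysis.FluidPDE

/-- **Tao 2013, Thm. 5.4 (ii)+(iv) for smooth `H^∞` data, discharged.** There is an absolute
`c > 0` such that for `ν > 0`, `T > 0` and a smooth divergence-free `u₀ : ℝ³ → ℝ³` with all
derivatives in `L²` and `‖u₀‖⁴_{H¹} T ≤ c ν³` there is a classical solution on `[0, T] × ℝ³` from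
`u₀` with `u, ∂ₜu, p ∈ L^∞_t H^k_x` for all `k` and `u ∈ C([0,T]; L²)`. Proof: the accepted
assembly `tao2011_smooth_local_existence_of_fourier` fed with the discharged Fourier-side theorem
`tao2011_fourier_local_existence_holds` and the discharged Plancherel bridge
`sobolev_fourierDatum_of_smooth_holds`. [cite: Tao2011, Thm. 5.4 (ii)+(iv)] -/
theorem tao2011_smooth_local_existence_holds : tao2011_smooth_local_existence :=
  tao2011_smooth_local_existence_of_fourier tao2011_fourier_local_existence_holds
    sobolev_fourierDatum_of_smooth_holds

/-- **Tao 2013, Thm. 5.4 (i)–(ii) with Prop. 5.6 for `H¹` data, discharged**: there is an absolute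
`c > 0` such that every divergence-free `u₀ ∈ H¹(ℝ³)` with `‖u₀‖⁴_{H¹} T ≤ c ν³` launches a
Leray–Hopf weak solution on `[0, T)` attaining `u₀`, `H¹`-continuous on `[0, T]` and represented by
a classical solution of Tao's class on every `[τ, T]`, `0 < τ < T`. Proof: the accepted
approximation argument `tao2011_H1_local_almost_regular_of_smooth_local_existence` applied to
`tao2011_smooth_local_existence_holds`. [cite: Tao2011, Thm. 5.4 (i)-(ii) and Prop. 5.6] -/
theorem tao2011_H1_local_almost_regular_holds : tao2011_H1_local_almost_regular :=
  tao2011_H1_local_almost_regular_of_smooth_local_existence tao2011_smooth_local_existence_holds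

/-- **Leray's continuation theorem — Cheskidov–Shvydkoy 2010, Thm. 2.4 ("Leray"), case `s = 1`,
discharged.** For `ν > 0` and a Leray–Hopf weak solution `u` of the unforced Navier–Stokes system
on `ℝ³ × [0, T)`: if `limsup_{t → β⁻} ‖u(t)‖²_{H¹} < ∞` at the right end of every open interval
`(α, β) ⊆ (0, T)` on which `u` is `H¹`-regular, then `u` is `H¹`-regular on `(0, T]` (printed,
p. 4 of arXiv:0708.3067: "If for every interval of regularity `(α, β) ⊂ (0,T)`,
`limsup_{t→β-} ‖u(t)‖_{H^s} < ∞` for some `s > 1/2`, then `u(t)` is regular on `(0,T]`" — "a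
well-known fact concerning Leray–Hopf solutions"). Proof: the accepted derivation from Tao's local
`H¹` theory `leray_continuation_H1_of_tao` (restart at good times, local almost regular solution,
weak–strong uniqueness `serrin_weak_strong_uniqueness_holds`, supremum of the interval of
regularity; Robinson–Rodrigo–Sadowski 2016, Lemma 6.11 and Thm. 8.14) applied to
`tao2011_H1_local_almost_regular_holds`. [cite: CheskidovShvydkoy2010, Thm. 2.4 (case s = 1)] -/
theorem leray_continuation_H1_holds : leray_continuation_H1 :=
  leray_continuation_H1_of_tao tao2011_H1_local_almost_regular_holds

/-- **Ladyzhenskaya–Prodi–Serrin conditional regularity (ns.S07), discharged**: a Leray–Hopf weak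
solution of the unforced system on `ℝ³ × [0, T)` lying in a Serrin class `L^q(0,T; L^r)`,
`2/q + 3/r ≤ 1`, `3 < r`, has a classical representative on `(0, T]` (Prodi 1959; Serrin 1962;
Ladyzhenskaya 1967; Robinson–Rodrigo–Sadowski 2016, Thm. 8.17 with Lemma 8.16). Proof: the accepted
`ladyzhenskaya_prodi_serrin_of_tao` (Serrin's enstrophy estimate bounds `‖u(t)‖_{H¹}` to the left
of the end of every interval of regularity, the continuation theorem gives `H¹`-regularity on
`(0, T]`, and Tao's almost regular local solutions represent the restarts classically) applied to
`tao2011_H1_local_almost_regular_holds`. [cite: RobinsonRodrigoSadowski2016, Thm. 8.17 (with Lemma 8.16)] -/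
theorem ladyzhenskaya_prodi_serrin_holds : ladyzhenskaya_prodi_serrin :=
  ladyzhenskaya_prodi_serrin_of_tao tao2011_H1_local_almost_regular_holds

/-- **Robinson–Rodrigo–Sadowski 2016, Lemma 8.16 (Serrin regularity from an `H¹` slice),
discharged**: the named fact `serrin_regularity_H1` (`NSSerrinRegularity.lean`), by the accepted
`serrin_regularity_H1_of_tao` applied to `tao2011_H1_local_almost_regular_holds`.
[cite: RobinsonRodrigoSadowski2016, Lemma 8.16] -/
theorem serrin_regularity_H1_holds : serrin_regularity_H1 :=
  serrin_regularity_H1_of_tao tao2011_H1_local_almost_regular_holds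

/-- **Cheskidov–Shvydkoy 2010, Thm. 3.1 from their Lemma 3.2 alone.** The accepted regularity
criterion in `B^{-1}_{∞,∞}` (`cheskidov_shvydkoy`, ns.S31) follows from the dyadic criterion
`cheskidov_shvydkoy_dyadic_regular` (Lemma 3.2, p. 5 of arXiv:0708.3067: the frequency-localised
energy estimates) — the printed proof of Thm. 3.1 (p. 6) uses Lemma 3.2, Thm. 2.4 and the passage
from "regular" to a classical representative, and the latter two are now theorems
(`leray_continuation_H1_holds`, `ladyzhenskaya_prodi_serrin_holds`); the assembly is the accepted
`cheskidov_shvydkoy_of_regular`. [cite: CheskidovShvydkoy2010, Thm. 3.1 (proof, p. 6)] -/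
theorem cheskidov_shvydkoy_of_dyadic_regular (h32 : cheskidov_shvydkoy_dyadic_regular) :
    cheskidov_shvydkoy :=
  cheskidov_shvydkoy_of_regular h32 leray_continuation_H1_holds ladyzhenskaya_prodi_serrin_holds

end Literature.Analysis.FluidPDE

end
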